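import Mathlib
import Literature.NumberTheory.Transcendental.SemialgebraicMaps
import HarnessLib
import HarnessLib.Audit

/-!
# SoloInformed — half-angle coordinates: the functions `S`, `C` and the Calabi triangle

Trigonometry-free bookkeeping for Calabi's change of variables (`SoloInformedCalabiMap`,
`SoloInformedZetaTwo`): the Weierstrass half-angle functions `S(t) = 2t/(1+t²)` (`= sin u` at
`t = tan(u/2)`) and `C(t) = (1−t²)/(1+t²)` (`= cos u`), the key inequality
`S(a) < C(b) ⟺ a + b + ab < 1` (i.e. `u + v < π/2`) for `a ∈ (0,1)`, `b ≥ 0`, the half-angle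
inversion `S(s/(1+c)) = s`, `C(s/(1+c)) = c` on the circle, and the semialgebraic sets of the
construction — the open unit square, the Calabi triangle `T = {a, b > 0, a + b + ab < 1}`, the
co-triangle `T' = (0,1)² ∩ {a + b + ab > 1}` — with the nullity of the separating curve
`{a + b + ab = 1}` (so that `(0,1)² = T ⊔ T'` up to a null set, for rule (1a)).
[Beukers–Calabi–Kolk, Nieuw Arch. Wisk. (4) 11 (1993) 217–224; Kontsevich–Zagier 2001, §1.2]

Residency `solo-KontsevichZagierPeriods-informed` (PLAN.md, session s17).
-/

noncomputable section

namespace Summit.KontsevichZagierPeriods.KontsevichZagierPeriods.Theorems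

open Literature.NumberTheory.Transcendental MvPolynomial Set MeasureTheory

/-! ### Weierstrass half-angle functions `S(t) = 2t/(1+t²)`, `C(t) = (1−t²)/(1+t²)` -/

/-- `S(t) = 2t/(1+t²)` (`= sin u` for `t = tan(u/2)`). -/
def soloInformedHS (t : ℝ) : ℝ := 2 * t / (1 + t ^ 2)

/-- `C(t) = (1−t²)/(1+t²)` (`= cos u` for `t = tan(u/2)`). -/
def soloInformedHC (t : ℝ) : ℝ := (1 - t ^ 2) / (1 + t ^ 2)

/-- `S² + C² = 1` (the half-angle point lies on the unit circle). -/
theorem soloInformed_hS_sq_add_hC_sq (t : ℝ) : soloInformedHS t ^ 2 + soloInformedHC t ^ 2 = 1 := by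
  have h : (1 + t ^ 2 : ℝ) ≠ 0 := by positivity
  unfold soloInformedHS soloInformedHC
  field_simp
  ring

/-- `S(t) > 0` for `t > 0`. -/
theorem soloInformed_hS_pos {t : ℝ} (ht : 0 < t) : 0 < soloInformedHS t := by
  unfold soloInformedHS; positivity

/-- `C(t) > 0` for `0 ≤ t < 1`. -/
theorem soloInformed_hC_pos {t : ℝ} (h0 : 0 ≤ t) (h1 : t < 1) : 0 < soloInformedHC t := by
  unfold soloInformedHC
  exact div_pos (by nlinarith) (by positivity)

/-- `S(t) ≤ 1`. -/
theorem soloInformed_hS_le_one (t : ℝ) : soloInformedHS t ≤ 1 := by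
  unfold soloInformedHS
  exact (div_le_one (by positivity)).2 (by nlinarith [sq_nonneg (1 - t)])

/-- `S` is injective on `(0, 1)`. -/
theorem soloInformed_hS_inj {t t' : ℝ} (ht : 0 < t) (ht1 : t < 1) (ht' : 0 < t') (ht1' : t' < 1)
    (h : soloInformedHS t = soloInformedHS t') : t = t' := by
  unfold soloInformedHS at h
  rw [div_eq_div_iff (by positivity) (by positivity)] at h
  have h2 : (t - t') * (1 - t * t') = 0 := by nlinarith [h]
  rcases mul_eq_zero.1 h2 with h3 | h3
  · linarith
  · nlinarith [mul_lt_mul'' ht1 ht1' ht.le ht'.le]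

/-- The factorisation behind `u + v < π/2 ⟺ sin u < cos v`: for `a ∈ (0,1)`, `b ≥ 0`,
`S(a) < C(b) ⟺ a + b + ab < 1` (since `(1−b²)(1+a²) − 2a(1+b²) = (1−a−b−ab)(1−a+b+ab)`). -/
theorem soloInformed_hS_lt_hC_iff {a b : ℝ} (ha : 0 < a) (ha1 : a < 1) (hb : 0 ≤ b) :
    soloInformedHS a < soloInformedHC b ↔ a + b + a * b < 1 := by
  unfold soloInformedHS soloInformedHC
  rw [div_lt_div_iff₀ (by positivity) (by positivity)]
  have key : (1 - b ^ 2) * (1 + a ^ 2) - 2 * a * (1 + b ^ 2) =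
      (1 - a - b - a * b) * (1 - a + b + a * b) := by ring
  have hpos : 0 < 1 - a + b + a * b := by nlinarith
  constructor
  · intro h
    by_contra hc
    have h1 : 1 - a - b - a * b ≤ 0 := by linarith [not_lt.1 hc]
    nlinarith [mul_nonpos_of_nonpos_of_nonneg h1 hpos.le]
  · intro h
    have h1 : 0 < 1 - a - b - a * b := by linarith
    nlinarith [mul_pos h1 hpos]

/-- The half-angle substitution: if `s² + c² = 1` and `c > −1` then `t = s/(1+c)` has
`S(t) = s` and `C(t) = c`. -/
theorem soloInformed_halfAngle {s c : ℝ} (h : s ^ 2 + c ^ 2 = 1) (hc : 0 < 1 + c) :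
    soloInformedHS (s / (1 + c)) = s ∧ soloInformedHC (s / (1 + c)) = c := by
  have hc' : (1 + c) ≠ 0 := hc.ne'
  have hs2 : s ^ 2 = (1 - c) * (1 + c) := by nlinarith [h]
  have h1 : 1 + (s / (1 + c)) ^ 2 = 2 / (1 + c) := by
    rw [div_pow, hs2]; field_simp; ring
  constructor
  · unfold soloInformedHS; rw [h1]; field_simp
  · unfold soloInformedHC; rw [h1, div_pow, hs2]; field_simp; ring

/-! ### The sets: open unit square, Calabi triangle, co-triangle, separating curve -/

/-- The open unit square `(0,1)²`, in the box shape of `BoxIntegralZetaValues`. -/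
def soloInformedOpenSq : Set (Fin 2 → ℝ) := {x | ∀ i, x i ∈ Ioo (0 : ℝ) 1}

/-- Membership in the open unit square. -/
theorem soloInformed_mem_openSq {x : Fin 2 → ℝ} :
    x ∈ soloInformedOpenSq ↔ (0 < x 0 ∧ x 0 < 1) ∧ (0 < x 1 ∧ x 1 < 1) := by
  simp [soloInformedOpenSq, Fin.forall_fin_two]

/-- The Calabi triangle `T = {a > 0, b > 0, a + b + ab < 1}` (the image of `{u, v > 0, u + v < π/2}`
under `(tan(u/2), tan(v/2))`). -/
def soloInformedCalabiSrc : Set (Fin 2 → ℝ) := {u | 0 < u 0 ∧ 0 < u 1 ∧ u 0 + u 1 + u 0 * u 1 < 1}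

/-- The co-triangle `T' = (0,1)² ∩ {a + b + ab > 1}`. -/
def soloInformedCalabiCo : Set (Fin 2 → ℝ) :=
  {u | (0 < u 0 ∧ u 0 < 1) ∧ (0 < u 1 ∧ u 1 < 1) ∧ 1 < u 0 + u 1 + u 0 * u 1}

/-- Points of the Calabi triangle have both coordinates `< 1`. -/
theorem soloInformed_lt_one_of_mem_calabiSrc {u : Fin 2 → ℝ} (hu : u ∈ soloInformedCalabiSrc) :
    u 0 < 1 ∧ u 1 < 1 := by
  obtain ⟨h0, h1, h⟩ := hu
  constructor <;> nlinarith [mul_pos h0 h1]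

/-- The Calabi triangle lies in the open square. -/
theorem soloInformedCalabiSrc_subset_openSq : soloInformedCalabiSrc ⊆ soloInformedOpenSq := by
  intro u hu
  have h := soloInformed_lt_one_of_mem_calabiSrc hu
  exact soloInformed_mem_openSq.2 ⟨⟨hu.1, h.1⟩, hu.2.1, h.2⟩

/-- The co-triangle lies in the open square. -/
theorem soloInformedCalabiCo_subset_openSq : soloInformedCalabiCo ⊆ soloInformedOpenSq :=
  fun _ hu => soloInformed_mem_openSq.2 ⟨hu.1, hu.2.1⟩

/-- The open square is `ℚ`-semialgebraic. -/
theorem isSemialgebraic_soloInformedOpenSq :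
    Literature.ModelTheory.ExponentialFields.IsSemialgebraic ℚ soloInformedOpenSq := by
  have h1 := Literature.ModelTheory.ExponentialFields.isSemialgebraic_setOf_eval_lt (k := ℚ) (R := ℝ)
    (0 : MvPolynomial (Fin 2) ℚ) (X 0)
  have h2 := Literature.ModelTheory.ExponentialFields.isSemialgebraic_setOf_eval_lt (k := ℚ) (R := ℝ)
    (X 0 : MvPolynomial (Fin 2) ℚ) 1
  have h3 := Literature.ModelTheory.ExponentialFields.isSemialgebraic_setOf_eval_lt (k := ℚ) (R := ℝ)
    (0 : MvPolynomial (Fin 2) ℚ) (X 1)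
  have h4 := Literature.ModelTheory.ExponentialFields.isSemialgebraic_setOf_eval_lt (k := ℚ) (R := ℝ)
    (X 1 : MvPolynomial (Fin 2) ℚ) 1
  have h := (h1.inter h2).inter (h3.inter h4)
  simp only [map_zero, map_one, aeval_X] at h
  have hset : soloInformedOpenSq = ({u : Fin 2 → ℝ | 0 < u 0} ∩ {u | u 0 < 1}) ∩
      ({u | 0 < u 1} ∩ {u | u 1 < 1}) := by
    ext u; simp [soloInformed_mem_openSq]
  rw [hset]; exact h

/-- The Calabi triangle is `ℚ`-semialgebraic. -/
theorem isSemialgebraic_soloInformedCalabiSrc :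
    Literature.ModelTheory.ExponentialFields.IsSemialgebraic ℚ soloInformedCalabiSrc := by
  have h1 := Literature.ModelTheory.ExponentialFields.isSemialgebraic_setOf_eval_lt (k := ℚ) (R := ℝ)
    (0 : MvPolynomial (Fin 2) ℚ) (X 0)
  have h2 := Literature.ModelTheory.ExponentialFields.isSemialgebraic_setOf_eval_lt (k := ℚ) (R := ℝ)
    (0 : MvPolynomial (Fin 2) ℚ) (X 1)
  have h3 := Literature.ModelTheory.ExponentialFields.isSemialgebraic_setOf_eval_lt (k := ℚ) (R := ℝ)
    (X 0 + X 1 + X 0 * X 1 : MvPolynomial (Fin 2) ℚ) 1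
  have h := h1.inter (h2.inter h3)
  simp only [map_zero, map_one, map_add, map_mul, aeval_X] at h
  have hset : soloInformedCalabiSrc = {u : Fin 2 → ℝ | 0 < u 0} ∩ ({u | 0 < u 1} ∩
      {u | u 0 + u 1 + u 0 * u 1 < 1}) := by
    ext u; simp [soloInformedCalabiSrc]
  rw [hset]; exact h

/-- The co-triangle is `ℚ`-semialgebraic. -/
theorem isSemialgebraic_soloInformedCalabiCo :
    Literature.ModelTheory.ExponentialFields.IsSemialgebraic ℚ soloInformedCalabiCo := by
  have h3 := Literature.ModelTheory.ExponentialFields.isSemialgebraic_setOf_eval_lt (k := ℚ) (R := ℝ)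
    1 (X 0 + X 1 + X 0 * X 1 : MvPolynomial (Fin 2) ℚ)
  have h := isSemialgebraic_soloInformedOpenSq.inter h3
  simp only [map_one, map_add, map_mul, aeval_X] at h
  have hset : soloInformedCalabiCo = soloInformedOpenSq ∩ {u | 1 < u 0 + u 1 + u 0 * u 1} := by
    ext u; simp [soloInformedCalabiCo, soloInformed_mem_openSq, and_assoc]
  rw [hset]; exact h

/-- The separating curve `{a + b + ab = 1, a ≥ 0}` is null (the image of a segment of the null
line `{b = 0}` under the smooth map `a ↦ (a, (1−a)/(1+a))`). -/
theorem soloInformed_volume_calabiCurve :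
    volume {u : Fin 2 → ℝ | 0 ≤ u 0 ∧ u 0 + u 1 + u 0 * u 1 = 1} = 0 := by
  set s : Set (Fin 2 → ℝ) := {u | 0 ≤ u 0 ∧ u 1 = 0} with hs
  set f : (Fin 2 → ℝ) → (Fin 2 → ℝ) := fun u => ![u 0, (1 - u 0) / (1 + u 0)] with hf
  have hsnull : volume s = 0 := by
    have hax : volume {u : Fin 2 → ℝ | u 1 = 0} = 0 := by
      rw [volume_pi]; exact Measure.pi_hyperplane _ _ _
    exact measure_mono_null (fun u hu => hu.2) hax
  have hdiff : DifferentiableOn ℝ f s := by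
    refine differentiableOn_pi.2 fun i => ?_
    fin_cases i
    · simp only [hf, Fin.zero_eta, Matrix.cons_val_zero]; fun_prop
    · simp only [hf, Fin.mk_one, Matrix.cons_val_one, Matrix.cons_val_zero]
      have h1 : DifferentiableOn ℝ (fun u : Fin 2 → ℝ => 1 - u 0) s := by fun_prop
      have h2 : DifferentiableOn ℝ (fun u : Fin 2 → ℝ => 1 + u 0) s := by fun_prop
      have h3 : DifferentiableOn ℝ
          ((fun u : Fin 2 → ℝ => 1 - u 0) * (fun u : Fin 2 → ℝ => 1 + u 0)⁻¹) s :=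
        h1.mul (h2.inv fun (u : Fin 2 → ℝ) (hu : u ∈ s) => by have : 0 ≤ u 0 := hu.1; linarith)
      exact h3.congr fun u _ => by simp [div_eq_mul_inv]
  have himg := addHaar_image_eq_zero_of_differentiableOn_of_addHaar_eq_zero volume hdiff hsnull
  refine measure_mono_null (fun u hu => ?_) himg
  obtain ⟨h0, heq⟩ := hu
  refine ⟨![u 0, 0], ⟨by simpa using h0, by simp⟩, ?_⟩
  have h1 : (1 + u 0) ≠ 0 := by linarith
  have hu1 : u 1 = (1 - u 0) / (1 + u 0) := by
    rw [eq_div_iff h1]; linarith [heq]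
  funext i
  fin_cases i
  · simp [hf]
  · simp [hf, hu1]

/-- `(0,1)² ∖ (T ∪ T')` lies on the separating curve, hence is null. -/
theorem soloInformed_volume_openSq_diff :
    volume (soloInformedOpenSq \ (soloInformedCalabiSrc ∪ soloInformedCalabiCo)) = 0 := by
  refine measure_mono_null (fun u hu => ?_) soloInformed_volume_calabiCurve
  obtain ⟨hsq, hn⟩ := hu
  rw [soloInformed_mem_openSq] at hsq
  simp only [mem_union, soloInformedCalabiSrc, soloInformedCalabiCo, mem_setOf_eq, not_or] at hn
  refine ⟨hsq.1.1.le, ?_⟩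
  by_contra hne
  rcases lt_or_gt_of_ne hne with h | h
  · exact hn.1 ⟨hsq.1.1, hsq.2.1, h⟩
  · exact hn.2 ⟨hsq.1, hsq.2, h⟩

end Summit.KontsevichZagierPeriods.KontsevichZagierPeriods.Theorems
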